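import Literature.NumberTheory.EllipticCurves.BhargavaShankarJacobianCV
import Literature.NumberTheory.EllipticCurves.BhargavaShankarVolumes
import Literature.NumberTheory.EllipticCurves.BinaryQuarticRealTransitivityProofs
import Literature.NumberTheory.EllipticCurves.BinaryQuarticRealStabilizerProofs
import Mathlib.Analysis.Calculus.Deriv.MeanValue
import Mathlib.Topology.Order.IntermediateValue
import HarnessLib

/-!
# The cone families of sections for the four real types (Bhargava–Shankar's fundamental sets `L_V^{(i)}`)

Topic `Literature/NumberTheory/EllipticCurves`; continues `BhargavaShankarJacobianCV.lean` (the
change of variables `Ψ` for an arbitrary `C¹` two-parameter family `SmoothFamily`). Everything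
here is PROVED (no named facts).

Bhargava–Shankar (Ann. of Math. 181 (2015), §2.1 of `arXiv:1006.1002v2`) choose fundamental sets
`L_V^{(i)}` for `GL₂(ℝ)` acting on `V_ℝ^{(i)}`: "one form `f ∈ V_ℝ^{(i)}` for each `(I, J)` with
`H(I,J) = 1`" (Table 1 of the paper, whose explicit forms are not in the held text), all with
uniformly bounded coefficients, and set `R_V^{(i)} = Λ L_V^{(i)}` (eq. before Prop. 2.7). This
file constructs such sets concretely as **cones `P(m, τ) = m · c(τ)` over `C¹` curves** lying on
`{H = 1}` and proves what the counting needs: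

* `SmoothCurve`, `SmoothCurve.cone : SmoothFamily` and `∂(I,J)/∂(m,τ) = m⁴ ι(τ)` with
  `ι = 2 I(c) dJ_c(c') − 3 J(c) dI_c(c')` (`jacIJ_cone`); chain rules `hasDerivAt_I/J`;
* the five curves: `curve0 = q_{1,τ}` (`τ ∈ (−2,2)`, type `0`), `curve1B = q_{−1,τ}` (`τ ∈ [−2,2]`),
  `curve1C = q_{τ,2}`, `curve1D = q_{τ,−2}` (`τ ∈ (−1,1)`) (type `1`), and
  `curve2(s) = (12+s²)^{-1/2}(x⁴ + s x²y² + y⁴)` (`s ∈ (−2,2)`, type `2+`), where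
  `q_{I,J} = x³y − (I/3)xy³ − (J/27)y⁴`; their invariants, `ι ≡ 2, −2, −6, 6` and
  `ι₂(s) = 432 (12+s²)^{-5/2}(4 − s²)`, discriminants, definiteness and heights `H = 1`;
* the type-`2` invariant `j(s) = J(c₂(s))`: a strictly increasing bijection `[−2,2] → [−2,2]`
  (`strictMonoOn_jfun`, `exists_jfun_eq`);
* **coverage** (`exists_cone0_subst`, `exists_cone1_subst`, `exists_cone2_subst`): every real form
  of type `i` with `Δ ≠ 0` is `SL₂^±(ℝ)`-equivalent (for `2+`: `SL₂(ℝ)`-equivalent) to a cone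
  point `m · c(τ)`, `m > 0`, `τ` in the piece's interval — by the transitivity theorems of
  `BinaryQuarticRealTransitivityProofs.lean` (B–S §2.1, facts 1–2); and **uniqueness** of the
  cone point with given invariants (`cone*_params_unique`, `cone1*_invariants`).

## References

* M. Bhargava, A. Shankar, Ann. of Math. (2) 181 (2015) 191–242, §2.1 (fundamental sets
  `L_V^{(i)}`, Table 1), §2.4 (`R_V^{(i)} = Λ L_V^{(i)}`, `p^{(i)}_{I,J}`); arXiv:1006.1002v2
  numbering. [cite: BhargavaShankarAnnals2015, §2.1 (fundamental sets L_V^{(i)}; arXiv:1006.1002v2 numbering)]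
-/

noncomputable section

open Real MeasureTheory Matrix

namespace Literature.NumberTheory.EllipticCurves

namespace BinaryQuartic

/-! ## Homogeneity of `dI`, `dJ` -/

/-- `dI` is linear in the form: `dI_{m f}(w) = m dI_f(w)`. [folklore] -/
theorem dI_smul_left (m : ℝ) (f w : BinaryQuartic ℝ) : dI (m • f) w = m * dI f w := by
  simp only [dI, smul_a, smul_b, smul_c, smul_d, smul_e]; ring

/-- `dJ` is quadratic in the form: `dJ_{m f}(w) = m² dJ_f(w)`. [folklore] -/
theorem dJ_smul_left (m : ℝ) (f w : BinaryQuartic ℝ) : dJ (m • f) w = m ^ 2 * dJ f w := by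
  simp only [dJ, smul_a, smul_b, smul_c, smul_d, smul_e]; ring

/-! ## Cone families `P(m, τ) = m · c(τ)` over a `C¹` curve -/

/-- A `C¹` curve of forms `c(τ)` with its derivative `c'(τ)`. [folklore] -/
structure SmoothCurve where
  /-- the curve -/
  c : ℝ → BinaryQuartic ℝ
  /-- its derivative -/
  c' : ℝ → BinaryQuartic ℝ
  /-- `c` is `C¹` coefficientwise -/
  contDiff_a : ContDiff ℝ 1 fun τ => (c τ).a
  contDiff_b : ContDiff ℝ 1 fun τ => (c τ).b
  contDiff_c : ContDiff ℝ 1 fun τ => (c τ).c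
  contDiff_d : ContDiff ℝ 1 fun τ => (c τ).d
  contDiff_e : ContDiff ℝ 1 fun τ => (c τ).e
  /-- `c'` is the derivative -/
  hasDerivAt : ∀ τ, HasDerivAt (fun s => (c s).coeffs) (c' τ).coeffs τ

namespace SmoothCurve

variable (C : SmoothCurve)

/-- The cone family `P(m, τ) = m · c(τ)` over the curve, with `P_m = c(τ)`, `P_τ = m · c'(τ)`.
[folklore] -/
def cone : SmoothFamily where
  P := fun m τ => m • C.c τ
  Pα := fun _ τ => C.c τ
  Pβ := fun m τ => m • C.c' τ
  contDiff_a := contDiff_fst.mul (C.contDiff_a.comp contDiff_snd)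
  contDiff_b := contDiff_fst.mul (C.contDiff_b.comp contDiff_snd)
  contDiff_c := contDiff_fst.mul (C.contDiff_c.comp contDiff_snd)
  contDiff_d := contDiff_fst.mul (C.contDiff_d.comp contDiff_snd)
  contDiff_e := contDiff_fst.mul (C.contDiff_e.comp contDiff_snd)
  hasDerivAt_α := by
    intro α β
    have e : (fun s : ℝ => (s • C.c β).coeffs) = fun s => s • (C.c β).coeffs := by
      funext s; exact coeffs_smul' s _
    rw [e]
    simpa using (hasDerivAt_id α).smul_const (C.c β).coeffs
  hasDerivAt_β := by
    intro α β
    have e : (fun s : ℝ => (α • C.c s).coeffs) = fun s => α • (C.c s).coeffs := by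
      funext s; exact coeffs_smul' α _
    rw [e, coeffs_smul']
    exact (C.hasDerivAt β).const_smul α

/-- The normalised Jacobian factor `ι(τ) = 2 I(c) dJ_c(c') − 3 J(c) dI_c(c')` (so that
`∂(I,J)/∂(m,τ) = m⁴ ι(τ)` for `P = m · c(τ)`: `I(P) = m² I(c)`, `J(P) = m³ J(c)`). [folklore] -/
def iota (τ : ℝ) : ℝ :=
  2 * (C.c τ).I * dJ (C.c τ) (C.c' τ) - 3 * (C.c τ).J * dI (C.c τ) (C.c' τ)

/-- **`∂(I,J)/∂(m,τ) = m⁴ ι(τ)`** for a cone family. [folklore] -/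
theorem jacIJ_cone (m τ : ℝ) : jacIJ C.cone m τ = m ^ 4 * C.iota τ := by
  simp only [jacIJ, cone, iota, dI_smul_left, dJ_smul_left, dI_smul, dJ_smul, dI_self, dJ_self]
  ring

/-- Invariants of the cone family: `I(m · c) = m² I(c)`. [folklore] -/
theorem I_cone (m τ : ℝ) : (C.cone.P m τ).I = m ^ 2 * (C.c τ).I := I_smul m _

/-- Invariants of the cone family: `J(m · c) = m³ J(c)`. [folklore] -/
theorem J_cone (m τ : ℝ) : (C.cone.P m τ).J = m ^ 3 * (C.c τ).J := J_smul m _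

end SmoothCurve

/-! ## The polynomial curves `q_{1,τ}`, `q_{−1,τ}`, `q_{τ,2}`, `q_{τ,−2}` -/

/-- Type `0` (and the first piece of nothing else): `c₀(τ) = q_{1,τ} = x³y − (1/3)xy³ − (τ/27)y⁴`,
`τ ∈ (−2, 2)` (`I = 1`, `J = τ`, `Δ > 0`, a real root at `y = 0`). [cite: BhargavaShankarAnnals2015, §2.1 (Table 1: fundamental sets L_V^{(i)}; arXiv:1006.1002v2 numbering)] -/
def curve0 : SmoothCurve where
  c := fun τ => ⟨0, 1, 0, -1 / 3, -τ / 27⟩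
  c' := fun _ => ⟨0, 0, 0, 0, -1 / 27⟩
  contDiff_a := contDiff_const
  contDiff_b := contDiff_const
  contDiff_c := contDiff_const
  contDiff_d := contDiff_const
  contDiff_e := by show ContDiff ℝ 1 fun τ : ℝ => -τ / 27; fun_prop
  hasDerivAt := by
    intro τ
    refine hasDerivAt_pi.2 fun i => ?_
    fin_cases i
    · simpa [coeffs] using hasDerivAt_const τ (0 : ℝ)
    · simpa [coeffs] using hasDerivAt_const τ (1 : ℝ)
    · simpa [coeffs] using hasDerivAt_const τ (0 : ℝ)
    · simpa [coeffs] using hasDerivAt_const τ (-1 / 3 : ℝ)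
    · simp only [coeffs, Fin.reduceFinMk, Matrix.cons_val]
      simpa using ((hasDerivAt_id τ).neg).div_const 27

/-- Type `1`, piece `B`: `q_{−1,τ} = x³y + (1/3)xy³ − (τ/27)y⁴`, `τ ∈ [−2, 2]` (`I = −1`,
`J = τ`). [cite: BhargavaShankarAnnals2015, §2.1 (Table 1; arXiv:1006.1002v2 numbering)] -/
def curve1B : SmoothCurve where
  c := fun τ => ⟨0, 1, 0, 1 / 3, -τ / 27⟩
  c' := fun _ => ⟨0, 0, 0, 0, -1 / 27⟩
  contDiff_a := contDiff_const
  contDiff_b := contDiff_const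
  contDiff_c := contDiff_const
  contDiff_d := contDiff_const
  contDiff_e := by show ContDiff ℝ 1 fun τ : ℝ => -τ / 27; fun_prop
  hasDerivAt := by
    intro τ
    refine hasDerivAt_pi.2 fun i => ?_
    fin_cases i
    · simpa [coeffs] using hasDerivAt_const τ (0 : ℝ)
    · simpa [coeffs] using hasDerivAt_const τ (1 : ℝ)
    · simpa [coeffs] using hasDerivAt_const τ (0 : ℝ)
    · simpa [coeffs] using hasDerivAt_const τ (1 / 3 : ℝ)
    · simp only [coeffs, Fin.reduceFinMk, Matrix.cons_val]
      simpa using ((hasDerivAt_id τ).neg).div_const 27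

/-- Type `1`, piece `C`: `q_{τ,2} = x³y − (τ/3)xy³ − (2/27)y⁴`, `τ ∈ (−1, 1)` (`I = τ`, `J = 2`).
[cite: BhargavaShankarAnnals2015, §2.1 (Table 1; arXiv:1006.1002v2 numbering)] -/
def curve1C : SmoothCurve where
  c := fun τ => ⟨0, 1, 0, -τ / 3, -2 / 27⟩
  c' := fun _ => ⟨0, 0, 0, -1 / 3, 0⟩
  contDiff_a := contDiff_const
  contDiff_b := contDiff_const
  contDiff_c := contDiff_const
  contDiff_d := by show ContDiff ℝ 1 fun τ : ℝ => -τ / 3; fun_prop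
  contDiff_e := contDiff_const
  hasDerivAt := by
    intro τ
    refine hasDerivAt_pi.2 fun i => ?_
    fin_cases i
    · simpa [coeffs] using hasDerivAt_const τ (0 : ℝ)
    · simpa [coeffs] using hasDerivAt_const τ (1 : ℝ)
    · simpa [coeffs] using hasDerivAt_const τ (0 : ℝ)
    · simp only [coeffs, Fin.reduceFinMk, Matrix.cons_val]
      simpa using ((hasDerivAt_id τ).neg).div_const 3
    · simpa [coeffs] using hasDerivAt_const τ (-2 / 27 : ℝ)

/-- Type `1`, piece `D`: `q_{τ,−2} = x³y − (τ/3)xy³ + (2/27)y⁴`, `τ ∈ (−1, 1)` (`I = τ`, `J = −2`).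
[cite: BhargavaShankarAnnals2015, §2.1 (Table 1; arXiv:1006.1002v2 numbering)] -/
def curve1D : SmoothCurve where
  c := fun τ => ⟨0, 1, 0, -τ / 3, 2 / 27⟩
  c' := fun _ => ⟨0, 0, 0, -1 / 3, 0⟩
  contDiff_a := contDiff_const
  contDiff_b := contDiff_const
  contDiff_c := contDiff_const
  contDiff_d := by show ContDiff ℝ 1 fun τ : ℝ => -τ / 3; fun_prop
  contDiff_e := contDiff_const
  hasDerivAt := by
    intro τ
    refine hasDerivAt_pi.2 fun i => ?_
    fin_cases i
    · simpa [coeffs] using hasDerivAt_const τ (0 : ℝ)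
    · simpa [coeffs] using hasDerivAt_const τ (1 : ℝ)
    · simpa [coeffs] using hasDerivAt_const τ (0 : ℝ)
    · simp only [coeffs, Fin.reduceFinMk, Matrix.cons_val]
      simpa using ((hasDerivAt_id τ).neg).div_const 3
    · simpa [coeffs] using hasDerivAt_const τ (2 / 27 : ℝ)

/-- `I(q_{1,τ}) = 1`. [folklore] -/
theorem I_curve0 (τ : ℝ) : (curve0.c τ).I = 1 := by simp only [curve0, I]; ring
/-- `J(q_{1,τ}) = τ`. [folklore] -/
theorem J_curve0 (τ : ℝ) : (curve0.c τ).J = τ := by simp only [curve0, J]; ring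
/-- `ι₀ ≡ 2`. [folklore] -/
theorem iota_curve0 (τ : ℝ) : curve0.iota τ = 2 := by
  simp only [SmoothCurve.iota, curve0, I, J, dI, dJ]; ring

/-- `I(q_{−1,τ}) = −1`. [folklore] -/
theorem I_curve1B (τ : ℝ) : (curve1B.c τ).I = -1 := by simp only [curve1B, I]; ring
/-- `J(q_{−1,τ}) = τ`. [folklore] -/
theorem J_curve1B (τ : ℝ) : (curve1B.c τ).J = τ := by simp only [curve1B, J]; ring
/-- `ι_{1B} ≡ −2`. [folklore] -/
theorem iota_curve1B (τ : ℝ) : curve1B.iota τ = -2 := by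
  simp only [SmoothCurve.iota, curve1B, I, J, dI, dJ]; ring

/-- `I(q_{τ,2}) = τ`. [folklore] -/
theorem I_curve1C (τ : ℝ) : (curve1C.c τ).I = τ := by simp only [curve1C, I]; ring
/-- `J(q_{τ,2}) = 2`. [folklore] -/
theorem J_curve1C (τ : ℝ) : (curve1C.c τ).J = 2 := by simp only [curve1C, J]; ring
/-- `ι_{1C} ≡ −6`. [folklore] -/
theorem iota_curve1C (τ : ℝ) : curve1C.iota τ = -6 := by
  simp only [SmoothCurve.iota, curve1C, I, J, dI, dJ]; ring

/-- `I(q_{τ,−2}) = τ`. [folklore] -/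
theorem I_curve1D (τ : ℝ) : (curve1D.c τ).I = τ := by simp only [curve1D, I]; ring
/-- `J(q_{τ,−2}) = −2`. [folklore] -/
theorem J_curve1D (τ : ℝ) : (curve1D.c τ).J = -2 := by simp only [curve1D, J]; ring
/-- `ι_{1D} ≡ 6`. [folklore] -/
theorem iota_curve1D (τ : ℝ) : curve1D.iota τ = 6 := by
  simp only [SmoothCurve.iota, curve1D, I, J, dI, dJ]; ring

/-! ## The type-`2` curve `(12 + s²)^{-1/2} (x⁴ + s x²y² + y⁴)` -/

/-- The normalising radius `r(s) = (12 + s²)^{-1/2}`. [folklore] -/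
def rad2 (s : ℝ) : ℝ := (Real.sqrt (12 + s ^ 2))⁻¹

/-- `12 + s² > 0`. [folklore] -/
theorem twelve_add_sq_pos (s : ℝ) : 0 < 12 + s ^ 2 := by positivity

/-- `r(s) > 0`. [folklore] -/
theorem rad2_pos (s : ℝ) : 0 < rad2 s := inv_pos.2 (Real.sqrt_pos.2 (twelve_add_sq_pos s))

/-- `r(s)² = (12 + s²)⁻¹`. [folklore] -/
theorem rad2_sq (s : ℝ) : rad2 s ^ 2 = (12 + s ^ 2)⁻¹ := by
  rw [rad2, inv_pow, Real.sq_sqrt (twelve_add_sq_pos s).le]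

/-- `r` is `C¹`. [folklore] -/
theorem contDiff_rad2 : ContDiff ℝ 1 rad2 := by
  have h : ∀ s : ℝ, 12 + s ^ 2 ≠ 0 := fun s => (twelve_add_sq_pos s).ne'
  have h2 : ∀ s : ℝ, Real.sqrt (12 + s ^ 2) ≠ 0 := fun s => (Real.sqrt_pos.2 (twelve_add_sq_pos s)).ne'
  unfold rad2
  fun_prop (disch := intro s; first | exact h s | exact h2 s)

/-- `r'(s) = −s (12 + s²)^{-3/2} = −s r(s)³`. [folklore] -/
theorem hasDerivAt_rad2 (s : ℝ) : HasDerivAt rad2 (-(s * rad2 s ^ 3)) s := by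
  have h1 : HasDerivAt (fun s : ℝ => 12 + s ^ 2) (2 * s) s := by
    simpa using ((hasDerivAt_id s).pow 2).const_add 12
  have h2 := h1.sqrt (twelve_add_sq_pos s).ne'
  have h3 := h2.inv (Real.sqrt_pos.2 (twelve_add_sq_pos s)).ne'
  refine h3.congr_deriv ?_
  have hs : Real.sqrt (12 + s ^ 2) ≠ 0 := (Real.sqrt_pos.2 (twelve_add_sq_pos s)).ne'
  rw [rad2]
  field_simp

/-- Type `2+`: `c₂(s) = (12 + s²)^{-1/2} (x⁴ + s x²y² + y⁴)`, `s ∈ (−2, 2)` (`I = 1`,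
`J = j(s) = 2s(36 − s²)(12 + s²)^{-3/2}`, positive definite). [cite: BhargavaShankarAnnals2015, §2.1 (Table 1: fundamental sets L_V^{(i)}; arXiv:1006.1002v2 numbering)] -/
def curve2 : SmoothCurve where
  c := fun s => ⟨rad2 s, 0, rad2 s * s, 0, rad2 s⟩
  c' := fun s => ⟨-(s * rad2 s ^ 3), 0, -(s * rad2 s ^ 3) * s + rad2 s, 0, -(s * rad2 s ^ 3)⟩
  contDiff_a := contDiff_rad2
  contDiff_b := contDiff_const
  contDiff_c := by show ContDiff ℝ 1 fun s => rad2 s * s; exact contDiff_rad2.mul contDiff_id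
  contDiff_d := contDiff_const
  contDiff_e := contDiff_rad2
  hasDerivAt := by
    intro s
    refine hasDerivAt_pi.2 fun i => ?_
    fin_cases i
    · simpa [coeffs] using hasDerivAt_rad2 s
    · simpa [coeffs] using hasDerivAt_const s (0 : ℝ)
    · simp only [coeffs, Fin.reduceFinMk, Matrix.cons_val]
      exact ((hasDerivAt_rad2 s).fun_mul (hasDerivAt_id' s)).congr_deriv (by ring)
    · simpa [coeffs] using hasDerivAt_const s (0 : ℝ)
    · simpa [coeffs] using hasDerivAt_rad2 s

/-- `r(s)² (12 + s²) = 1`. [folklore] -/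
theorem rad2_sq_mul (s : ℝ) : rad2 s ^ 2 * (12 + s ^ 2) = 1 := by
  rw [rad2_sq, inv_mul_cancel₀ (twelve_add_sq_pos s).ne']

/-- `I(c₂(s)) = 1`. [folklore] -/
theorem I_curve2 (s : ℝ) : (curve2.c s).I = 1 := by
  have h := rad2_sq_mul s
  simp only [curve2, I]
  linear_combination h

/-- `J(c₂(s)) = 2s(36 − s²) r³`. [folklore] -/
theorem J_curve2 (s : ℝ) : (curve2.c s).J = 2 * s * (36 - s ^ 2) * rad2 s ^ 3 := by
  simp only [curve2, J]; ring

/-- `dI_{c₂}(c₂') = 0` (the invariant `I ≡ 1` along the curve). [folklore] -/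
theorem dI_curve2 (s : ℝ) : dI (curve2.c s) (curve2.c' s) = 0 := by
  have h := rad2_sq_mul s
  simp only [curve2, dI]
  linear_combination (-2 * s * rad2 s ^ 2) * h

/-- `dJ_{c₂}(c₂') = 216 r⁵ (4 − s²)` (`= j'(s)`). [folklore] -/
theorem dJ_curve2 (s : ℝ) : dJ (curve2.c s) (curve2.c' s) = 216 * rad2 s ^ 5 * (4 - s ^ 2) := by
  have h := rad2_sq_mul s
  simp only [curve2, dJ]
  linear_combination (-6 * rad2 s ^ 3 * (12 - s ^ 2)) * h

/-- `ι₂(s) = 432 r⁵ (4 − s²)`. [folklore] -/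
theorem iota_curve2 (s : ℝ) : curve2.iota s = 432 * rad2 s ^ 5 * (4 - s ^ 2) := by
  rw [SmoothCurve.iota, I_curve2, dI_curve2, dJ_curve2]; ring

/-! ## Derivatives of `I` and `J` along a curve -/

namespace SmoothCurve

variable (C : SmoothCurve)

/-- Coordinate derivatives of the curve. [folklore] -/
theorem hasDerivAt_coord (τ : ℝ) (i : Fin 5) :
    HasDerivAt (fun s => (C.c s).coeffs i) ((C.c' τ).coeffs i) τ :=
  (hasDerivAt_pi.1 (C.hasDerivAt τ)) i

/-- **Chain rule for `I`**: `(d/dτ) I(c(τ)) = dI_{c(τ)}(c'(τ))`. [folklore] -/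
theorem hasDerivAt_I (τ : ℝ) : HasDerivAt (fun s => (C.c s).I) (dI (C.c τ) (C.c' τ)) τ := by
  have ha := C.hasDerivAt_coord τ 0
  have hb := C.hasDerivAt_coord τ 1
  have hc := C.hasDerivAt_coord τ 2
  have hd := C.hasDerivAt_coord τ 3
  have he := C.hasDerivAt_coord τ 4
  simp only [coeffs, Matrix.cons_val_zero, Matrix.cons_val_one, Matrix.cons_val, Fin.isValue] at ha hb hc hd he
  have h := (((ha.fun_mul he).const_mul 12).sub ((hb.fun_mul hd).const_mul 3)).add (hc.fun_pow 2)
  refine (h.congr_deriv ?_).congr_of_eventuallyEq (Filter.Eventually.of_forall fun s => ?_)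
  · simp only [dI]; ring
  · simp only [I, Pi.add_apply, Pi.sub_apply]; ring

/-- **Chain rule for `J`**: `(d/dτ) J(c(τ)) = dJ_{c(τ)}(c'(τ))`. [folklore] -/
theorem hasDerivAt_J (τ : ℝ) : HasDerivAt (fun s => (C.c s).J) (dJ (C.c τ) (C.c' τ)) τ := by
  have ha := C.hasDerivAt_coord τ 0
  have hb := C.hasDerivAt_coord τ 1
  have hc := C.hasDerivAt_coord τ 2
  have hd := C.hasDerivAt_coord τ 3
  have he := C.hasDerivAt_coord τ 4
  simp only [coeffs, Matrix.cons_val_zero, Matrix.cons_val_one, Matrix.cons_val, Fin.isValue] at ha hb hc hd he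
  have h := ((((((ha.fun_mul hc).fun_mul he).const_mul 72).add (((hb.fun_mul hc).fun_mul hd).const_mul 9)).sub
    ((ha.fun_mul (hd.fun_pow 2)).const_mul 27)).sub ((he.fun_mul (hb.fun_pow 2)).const_mul 27)).sub
    ((hc.fun_pow 3).const_mul 2)
  refine (h.congr_deriv ?_).congr_of_eventuallyEq (Filter.Eventually.of_forall fun s => ?_)
  · simp only [dJ]; ring
  · simp only [J, Pi.add_apply, Pi.sub_apply]; ring

/-- `I` is continuous along the curve. [folklore] -/
theorem continuous_I : Continuous fun s => (C.c s).I :=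
  continuous_iff_continuousAt.2 fun τ => (C.hasDerivAt_I τ).continuousAt

/-- `J` is continuous along the curve. [folklore] -/
theorem continuous_J : Continuous fun s => (C.c s).J :=
  continuous_iff_continuousAt.2 fun τ => (C.hasDerivAt_J τ).continuousAt

end SmoothCurve

/-! ## Discriminant and height under scaling -/

/-- `Δ(m f) = m⁶ Δ(f)`. [folklore] -/
theorem disc_smul_real (m : ℝ) (f : BinaryQuartic ℝ) : (m • f).disc = m ^ 6 * f.disc := by
  simp only [disc, smul_a, smul_b, smul_c, smul_d, smul_e]; ring

/-- `H(m² I, m³ J) = m⁶ H(I, J)`. [folklore] -/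
theorem realHeightIJ_scale (m I₀ J₀ : ℝ) :
    realHeightIJ (m ^ 2 * I₀) (m ^ 3 * J₀) = m ^ 6 * realHeightIJ I₀ J₀ := by
  unfold realHeightIJ
  rw [abs_mul, abs_of_nonneg (by positivity : (0:ℝ) ≤ m ^ 2), mul_pow, mul_pow,
    show (m ^ 2) ^ 3 = m ^ 6 by ring, show (m ^ 3) ^ 2 * J₀ ^ 2 / 4 = m ^ 6 * (J₀ ^ 2 / 4) by ring,
    mul_max_of_nonneg _ _ (by positivity : (0:ℝ) ≤ m ^ 6)]

/-- The height of a pair with `|I| = 1`, `|J| ≤ 2` or `|I| ≤ 1`, `|J| = 2` is `1`. [folklore] -/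
theorem realHeightIJ_eq_one_of {I₀ J₀ : ℝ} (hI : |I₀| ≤ 1) (hJ : |J₀| ≤ 2) (h : |I₀| = 1 ∨ |J₀| = 2) :
    realHeightIJ I₀ J₀ = 1 := by
  unfold realHeightIJ
  have hJ2 : J₀ ^ 2 / 4 ≤ 1 := by
    have : J₀ ^ 2 ≤ 4 := by nlinarith [abs_nonneg J₀, sq_abs J₀]
    linarith
  have hI3 : |I₀| ^ 3 ≤ 1 := by
    calc |I₀| ^ 3 ≤ 1 ^ 3 := pow_le_pow_left₀ (abs_nonneg _) hI 3
      _ = 1 := by norm_num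
  rcases h with h | h
  · rw [h, one_pow]; exact max_eq_left hJ2
  · have : J₀ ^ 2 / 4 = 1 := by nlinarith [sq_abs J₀]
    rw [this]; exact max_eq_right hI3

/-! ## Type and height of the points of the five cones -/

/-- `Δ(q_{1,τ}) = (4 − τ²)/27`. [folklore] -/
theorem disc_curve0 (τ : ℝ) : (curve0.c τ).disc = (4 - τ ^ 2) / 27 := by
  have h := twentySeven_mul_disc (curve0.c τ)
  rw [I_curve0, J_curve0] at h
  linarith

/-- `Δ(q_{−1,τ}) = −(4 + τ²)/27 < 0`. [folklore] -/
theorem disc_curve1B (τ : ℝ) : (curve1B.c τ).disc = (-4 - τ ^ 2) / 27 := by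
  have h := twentySeven_mul_disc (curve1B.c τ)
  rw [I_curve1B, J_curve1B] at h
  linarith

/-- `Δ(q_{τ,2}) = (4τ³ − 4)/27`. [folklore] -/
theorem disc_curve1C (τ : ℝ) : (curve1C.c τ).disc = (4 * τ ^ 3 - 4) / 27 := by
  have h := twentySeven_mul_disc (curve1C.c τ)
  rw [I_curve1C, J_curve1C] at h
  linarith

/-- `Δ(q_{τ,−2}) = (4τ³ − 4)/27`. [folklore] -/
theorem disc_curve1D (τ : ℝ) : (curve1D.c τ).disc = (4 * τ ^ 3 - 4) / 27 := by
  have h := twentySeven_mul_disc (curve1D.c τ)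
  rw [I_curve1D, J_curve1D] at h
  linarith

/-- A form vanishing at `(1, 0)` is not definite. [folklore] -/
theorem not_isDefinite_of_eval_one_zero {f : BinaryQuartic ℝ} (h : f.eval 1 0 = 0) : ¬ f.IsDefinite := by
  rintro (hp | hn)
  · exact (lt_irrefl 0) (h ▸ hp 1 0 (Or.inl one_ne_zero))
  · exact (lt_irrefl 0) (h ▸ hn 1 0 (Or.inl one_ne_zero))

/-- The type-`0` cone consists of non-definite forms (root at `y = 0`). [folklore] -/
theorem not_isDefinite_cone0 (m τ : ℝ) : ¬ (m • curve0.c τ).IsDefinite :=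
  not_isDefinite_of_eval_one_zero (by simp [eval, curve0])

/-- `H(q_{1,τ}) = 1` for `|τ| ≤ 2`. [folklore] -/
theorem realHeightIJ_curve0 {τ : ℝ} (hτ : |τ| ≤ 2) : realHeightIJ (curve0.c τ).I (curve0.c τ).J = 1 := by
  rw [I_curve0, J_curve0]; exact realHeightIJ_eq_one_of (by simp) hτ (Or.inl (by simp))

/-- `H(q_{−1,τ}) = 1` for `|τ| ≤ 2`. [folklore] -/
theorem realHeightIJ_curve1B {τ : ℝ} (hτ : |τ| ≤ 2) : realHeightIJ (curve1B.c τ).I (curve1B.c τ).J = 1 := by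
  rw [I_curve1B, J_curve1B]; exact realHeightIJ_eq_one_of (by simp) hτ (Or.inl (by simp))

/-- `H(q_{τ,2}) = 1` for `|τ| ≤ 1`. [folklore] -/
theorem realHeightIJ_curve1C {τ : ℝ} (hτ : |τ| ≤ 1) : realHeightIJ (curve1C.c τ).I (curve1C.c τ).J = 1 := by
  rw [I_curve1C, J_curve1C]; exact realHeightIJ_eq_one_of hτ (by norm_num) (Or.inr (by norm_num))

/-- `H(q_{τ,−2}) = 1` for `|τ| ≤ 1`. [folklore] -/
theorem realHeightIJ_curve1D {τ : ℝ} (hτ : |τ| ≤ 1) : realHeightIJ (curve1D.c τ).I (curve1D.c τ).J = 1 := by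
  rw [I_curve1D, J_curve1D]; exact realHeightIJ_eq_one_of hτ (by norm_num) (Or.inr (by norm_num))

/-! ## The function `j(s) = J(c₂(s))`: a strictly increasing bijection of `[−2, 2]` -/

/-- `j(s) = J(c₂(s)) = 2s(36 − s²)(12 + s²)^{-3/2}`. [folklore] -/
def jfun (s : ℝ) : ℝ := (curve2.c s).J

/-- `j(s) = 2s(36 − s²) r(s)³`. [folklore] -/
theorem jfun_eq (s : ℝ) : jfun s = 2 * s * (36 - s ^ 2) * rad2 s ^ 3 := J_curve2 s

/-- `j'(s) = 216 r⁵ (4 − s²)`. [folklore] -/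
theorem hasDerivAt_jfun (s : ℝ) : HasDerivAt jfun (216 * rad2 s ^ 5 * (4 - s ^ 2)) s := by
  have h := curve2.hasDerivAt_J s
  rw [dJ_curve2] at h
  exact h

/-- `j` is continuous. [folklore] -/
theorem continuous_jfun : Continuous jfun := curve2.continuous_J

/-- `r(2) = 1/4`. [folklore] -/
theorem rad2_two : rad2 2 = 1 / 4 := by
  rw [rad2, show (12 : ℝ) + 2 ^ 2 = 4 ^ 2 by norm_num, Real.sqrt_sq (by norm_num)]; norm_num

/-- `r(−s) = r(s)`. [folklore] -/
theorem rad2_neg (s : ℝ) : rad2 (-s) = rad2 s := by simp [rad2]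

/-- `j(2) = 2`. [folklore] -/
theorem jfun_two : jfun 2 = 2 := by rw [jfun_eq, rad2_two]; norm_num

/-- `j(−2) = −2`. [folklore] -/
theorem jfun_neg_two : jfun (-2) = -2 := by rw [jfun_eq, rad2_neg, rad2_two]; norm_num

/-- `j` is strictly increasing on `[−2, 2]` (`j' = 216 r⁵ (4 − s²) > 0` inside). [folklore] -/
theorem strictMonoOn_jfun : StrictMonoOn jfun (Set.Icc (-2) 2) := by
  refine strictMonoOn_of_deriv_pos (convex_Icc _ _) continuous_jfun.continuousOn ?_
  intro s hs
  rw [interior_Icc] at hs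
  rw [(hasDerivAt_jfun s).deriv]
  have hr := rad2_pos s
  have h4 : 0 < 4 - s ^ 2 := by nlinarith [hs.1, hs.2]
  positivity

/-- `j` is injective on `[−2, 2]`. [folklore] -/
theorem injOn_jfun : Set.InjOn jfun (Set.Icc (-2) 2) := strictMonoOn_jfun.injOn

/-- `j` maps `[−2, 2]` into `[−2, 2]`. [folklore] -/
theorem jfun_mem_Icc {s : ℝ} (hs : s ∈ Set.Icc (-2 : ℝ) 2) : jfun s ∈ Set.Icc (-2 : ℝ) 2 := by
  have hm := strictMonoOn_jfun.monotoneOn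
  constructor
  · rw [← jfun_neg_two]
    exact hm (by norm_num) hs hs.1
  · rw [← jfun_two]
    exact hm hs (by norm_num) hs.2

/-- `j` maps `(−2, 2)` into `(−2, 2)`. [folklore] -/
theorem jfun_mem_Ioo {s : ℝ} (hs : s ∈ Set.Ioo (-2 : ℝ) 2) : jfun s ∈ Set.Ioo (-2 : ℝ) 2 := by
  constructor
  · rw [← jfun_neg_two]
    exact strictMonoOn_jfun (by norm_num) ⟨hs.1.le, hs.2.le⟩ hs.1
  · rw [← jfun_two]
    exact strictMonoOn_jfun ⟨hs.1.le, hs.2.le⟩ (by norm_num) hs.2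

/-- **`j : (−2, 2) → (−2, 2)` is onto** (intermediate value theorem). [folklore] -/
theorem exists_jfun_eq {t : ℝ} (ht : t ∈ Set.Ioo (-2 : ℝ) 2) : ∃ s ∈ Set.Ioo (-2 : ℝ) 2, jfun s = t := by
  have hivt := intermediate_value_Icc (by norm_num : (-2 : ℝ) ≤ 2) continuous_jfun.continuousOn
  rw [jfun_neg_two, jfun_two] at hivt
  obtain ⟨s, hs, hst⟩ := hivt ⟨ht.1.le, ht.2.le⟩
  refine ⟨s, ⟨lt_of_le_of_ne hs.1 ?_, lt_of_le_of_ne hs.2 ?_⟩, hst⟩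
  · rintro rfl; rw [jfun_neg_two] at hst; linarith [ht.1]
  · rintro rfl; rw [jfun_two] at hst; linarith [ht.2]

/-- `|j(s)| < 2` on `(−2, 2)`. [folklore] -/
theorem abs_jfun_lt_two {s : ℝ} (hs : s ∈ Set.Ioo (-2 : ℝ) 2) : |jfun s| < 2 :=
  abs_lt.2 (jfun_mem_Ioo hs)

/-- `Δ(c₂(s)) = (4 − j(s)²)/27`. [folklore] -/
theorem disc_curve2 (s : ℝ) : (curve2.c s).disc = (4 - jfun s ^ 2) / 27 := by
  have h := twentySeven_mul_disc (curve2.c s)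
  rw [I_curve2] at h
  rw [jfun]
  linarith

/-- `Δ(c₂(s)) > 0` on `(−2, 2)`. [folklore] -/
theorem disc_curve2_pos {s : ℝ} (hs : s ∈ Set.Ioo (-2 : ℝ) 2) : 0 < (curve2.c s).disc := by
  rw [disc_curve2]
  have := abs_jfun_lt_two hs
  have h2 : jfun s ^ 2 < 4 := by
    have := abs_lt.1 this; nlinarith
  linarith

/-- The type-`2+` cone consists of positive definite forms (for `m > 0`, `s > −2`). [folklore] -/
theorem eval_cone2_pos {m s : ℝ} (hm : 0 < m) (hs : -2 < s) (x y : ℝ) (hxy : x ≠ 0 ∨ y ≠ 0) :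
    0 < (m • curve2.c s).eval x y := by
  rw [eval_smul]
  refine mul_pos hm ?_
  have hr := rad2_pos s
  simp only [curve2, eval]
  have key : 0 < x ^ 4 + s * (x ^ 2 * y ^ 2) + y ^ 4 := by
    have h1 : x ^ 4 + s * (x ^ 2 * y ^ 2) + y ^ 4 = (x ^ 2 - y ^ 2) ^ 2 + (2 + s) * (x ^ 2 * y ^ 2) := by ring
    rw [h1]
    have hs2 : 0 < 2 + s := by linarith
    by_cases hx : x = 0
    · subst hx
      have hy : y ≠ 0 := by tauto
      have hy2 : 0 < y ^ 2 := lt_of_le_of_ne (sq_nonneg y) (Ne.symm (pow_ne_zero 2 hy))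
      nlinarith [mul_pos hy2 hy2]
    · have hx2 : 0 < x ^ 2 := lt_of_le_of_ne (sq_nonneg x) (Ne.symm (pow_ne_zero 2 hx))
      by_cases hy : y = 0
      · subst hy
        nlinarith [mul_pos hx2 hx2]
      · have hy2 : 0 < y ^ 2 := lt_of_le_of_ne (sq_nonneg y) (Ne.symm (pow_ne_zero 2 hy))
        nlinarith [mul_pos hs2 (mul_pos hx2 hy2), sq_nonneg (x ^ 2 - y ^ 2)]
  nlinarith [key, hr]

/-- `H(c₂(s)) = 1` on `[−2, 2]`. [folklore] -/
theorem realHeightIJ_curve2 {s : ℝ} (hs : s ∈ Set.Icc (-2 : ℝ) 2) :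
    realHeightIJ (curve2.c s).I (curve2.c s).J = 1 := by
  rw [I_curve2]
  have := jfun_mem_Icc hs
  exact realHeightIJ_eq_one_of (by simp) (abs_le.2 this) (Or.inl (by simp))

/-! ## Invariants of the cone points -/

/-- `I(m q_{1,τ}) = m²`. [folklore] -/
theorem I_cone0_pt (m τ : ℝ) : (m • curve0.c τ).I = m ^ 2 := by rw [I_smul, I_curve0, mul_one]
/-- `J(m q_{1,τ}) = m³τ`. [folklore] -/
theorem J_cone0_pt (m τ : ℝ) : (m • curve0.c τ).J = m ^ 3 * τ := by rw [J_smul, J_curve0]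
/-- `I(m q_{−1,τ}) = −m²`. [folklore] -/
theorem I_cone1B_pt (m τ : ℝ) : (m • curve1B.c τ).I = -m ^ 2 := by rw [I_smul, I_curve1B]; ring
/-- `J(m q_{−1,τ}) = m³τ`. [folklore] -/
theorem J_cone1B_pt (m τ : ℝ) : (m • curve1B.c τ).J = m ^ 3 * τ := by rw [J_smul, J_curve1B]
/-- `I(m q_{τ,2}) = m²τ`. [folklore] -/
theorem I_cone1C_pt (m τ : ℝ) : (m • curve1C.c τ).I = m ^ 2 * τ := by rw [I_smul, I_curve1C]
/-- `J(m q_{τ,2}) = 2m³`. [folklore] -/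
theorem J_cone1C_pt (m τ : ℝ) : (m • curve1C.c τ).J = 2 * m ^ 3 := by rw [J_smul, J_curve1C]; ring
/-- `I(m q_{τ,−2}) = m²τ`. [folklore] -/
theorem I_cone1D_pt (m τ : ℝ) : (m • curve1D.c τ).I = m ^ 2 * τ := by rw [I_smul, I_curve1D]
/-- `J(m q_{τ,−2}) = −2m³`. [folklore] -/
theorem J_cone1D_pt (m τ : ℝ) : (m • curve1D.c τ).J = -(2 * m ^ 3) := by rw [J_smul, J_curve1D]; ring
/-- `I(m c₂(s)) = m²`. [folklore] -/
theorem I_cone2_pt (m s : ℝ) : (m • curve2.c s).I = m ^ 2 := by rw [I_smul, I_curve2, mul_one]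
/-- `J(m c₂(s)) = m³ j(s)`. [folklore] -/
theorem J_cone2_pt (m s : ℝ) : (m • curve2.c s).J = m ^ 3 * jfun s := by rw [J_smul, jfun]

/-- Two real forms with the same invariants have the same discriminant. [folklore] -/
theorem disc_eq_of_invariants_eq {f g : BinaryQuartic ℝ} (hI : f.I = g.I) (hJ : f.J = g.J) : f.disc = g.disc := by
  have h1 := twentySeven_mul_disc f
  have h2 := twentySeven_mul_disc g
  rw [hI, hJ] at h1
  linarith

/-- `4 I³ > J²` forces `I > 0`. [folklore] -/
theorem I_pos_of_disc_pos {f : BinaryQuartic ℝ} (h : 0 < f.disc) : 0 < f.I := by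
  have h1 := twentySeven_mul_disc f
  have h3 : 0 < f.I ^ 3 := by nlinarith [sq_nonneg f.J]
  by_contra hle
  push Not at hle
  have : f.I ^ 3 ≤ 0 := by
    have : f.I ^ 3 = f.I * f.I ^ 2 := by ring
    rw [this]; exact mul_nonpos_of_nonpos_of_nonneg hle (sq_nonneg _)
  linarith

/-! ## Coverage: every real form of type `i` is `SL₂^±(ℝ)`-equivalent to a unique cone point -/

/-- **Type `0`**: a real form with `Δ > 0` and a real root is `SL₂^±(ℝ)`-equivalent to
`m · q_{1,τ}` with `m = √I`, `τ = J/I^{3/2} ∈ (−2, 2)`. [cite: BhargavaShankarAnnals2015, §2.1 (fundamental sets L_V^{(0)}; arXiv:1006.1002v2 numbering)] -/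
theorem exists_cone0_subst {f : BinaryQuartic ℝ} (hΔ : 0 < f.disc) (hnd : ¬ f.IsDefinite) :
    ∃ m τ : ℝ, 0 < m ∧ τ ∈ Set.Ioo (-2 : ℝ) 2 ∧
      ∃ γ : Matrix (Fin 2) (Fin 2) ℝ, (γ.det = 1 ∨ γ.det = -1) ∧ f = (m • curve0.c τ).subst γ := by
  have hI := I_pos_of_disc_pos hΔ
  set m : ℝ := Real.sqrt f.I with hm
  have hm0 : 0 < m := Real.sqrt_pos.2 hI
  have hm2 : m ^ 2 = f.I := Real.sq_sqrt hI.le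
  have hm3 : m ^ 3 ≠ 0 := by positivity
  set τ : ℝ := f.J / m ^ 3 with hτ
  have hJ' : m ^ 3 * τ = f.J := by rw [hτ]; field_simp
  have h27 := twentySeven_mul_disc f
  have hτ2 : τ ^ 2 < 4 := by
    have h1 : f.J ^ 2 < 4 * f.I ^ 3 := by linarith
    have h2 : f.J ^ 2 = m ^ 6 * τ ^ 2 := by rw [← hJ']; ring
    have h3 : f.I ^ 3 = m ^ 6 := by rw [← hm2]; ring
    rw [h2, h3] at h1
    have hm6 : 0 < m ^ 6 := by positivity
    nlinarith
  have hτmem : τ ∈ Set.Ioo (-2 : ℝ) 2 := by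
    constructor <;> nlinarith [hτ2, sq_nonneg (τ + 2), sq_nonneg (τ - 2)]
  refine ⟨m, τ, hm0, hτmem, ?_⟩
  have hIP : (m • curve0.c τ).I = f.I := by rw [I_cone0_pt, hm2]
  have hJP : (m • curve0.c τ).J = f.J := by rw [J_cone0_pt, hJ']
  have hΔP : (m • curve0.c τ).disc ≠ 0 := by
    rw [disc_eq_of_invariants_eq hIP hJP]; exact hΔ.ne'
  exact exists_subst_eq_of_not_isDefinite_of_invariants_eq hΔP hΔ.ne' (not_isDefinite_cone0 m τ) hnd
    hIP hJP

/-- **Type `2+`**: a positive definite real form (with `Δ ≠ 0`) is `SL₂(ℝ)`-equivalent to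
`m · c₂(s)` with `m = √I`, `j(s) = J/I^{3/2}`, `s ∈ (−2, 2)`. [cite: BhargavaShankarAnnals2015, §2.1 (fundamental sets L_V^{(2+)}; arXiv:1006.1002v2 numbering)] -/
theorem exists_cone2_subst {f : BinaryQuartic ℝ} (hΔ : f.disc ≠ 0)
    (hpos : ∀ x y : ℝ, (x ≠ 0 ∨ y ≠ 0) → 0 < f.eval x y) :
    ∃ m s : ℝ, 0 < m ∧ s ∈ Set.Ioo (-2 : ℝ) 2 ∧
      ∃ γ : Matrix (Fin 2) (Fin 2) ℝ, γ.det = 1 ∧ f = (m • curve2.c s).subst γ := by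
  have hΔ' : 0 < f.disc := disc_pos_of_isDefinite (Or.inl hpos) hΔ
  have hI := I_pos_of_disc_pos hΔ'
  set m : ℝ := Real.sqrt f.I with hm
  have hm0 : 0 < m := Real.sqrt_pos.2 hI
  have hm2 : m ^ 2 = f.I := Real.sq_sqrt hI.le
  have hm3 : m ^ 3 ≠ 0 := by positivity
  set t : ℝ := f.J / m ^ 3 with ht
  have hJ' : m ^ 3 * t = f.J := by rw [ht]; field_simp
  have h27 := twentySeven_mul_disc f
  have ht2 : t ^ 2 < 4 := by
    have h1 : f.J ^ 2 < 4 * f.I ^ 3 := by linarith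
    have h2 : f.J ^ 2 = m ^ 6 * t ^ 2 := by rw [← hJ']; ring
    have h3 : f.I ^ 3 = m ^ 6 := by rw [← hm2]; ring
    rw [h2, h3] at h1
    have hm6 : 0 < m ^ 6 := by positivity
    nlinarith
  have htmem : t ∈ Set.Ioo (-2 : ℝ) 2 := by
    constructor <;> nlinarith [ht2, sq_nonneg (t + 2), sq_nonneg (t - 2)]
  obtain ⟨s, hs, hst⟩ := exists_jfun_eq htmem
  refine ⟨m, s, hm0, hs, ?_⟩
  have hIP : (m • curve2.c s).I = f.I := by rw [I_cone2_pt, hm2]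
  have hJP : (m • curve2.c s).J = f.J := by rw [J_cone2_pt, hst, hJ']
  exact exists_subst_eq_of_posDef_of_invariants_eq (eval_cone2_pos hm0 hs.1) hpos hIP hJP

/-- **Type `1`** (`Δ < 0`): `SL₂^±(ℝ)`-equivalence to a point of one of the three cone pieces:
`B` (`J² ≤ 4|I|³`, then `I < 0`): `m · q_{−1,τ}`, `τ ∈ [−2,2]`; `C` (`|I|³ < J²/4`, `J > 0`):
`m · q_{τ,2}`; `D` (`J < 0`): `m · q_{τ,−2}`, `τ ∈ (−1, 1)`. [cite: BhargavaShankarAnnals2015, §2.1 (fundamental sets L_V^{(1)}; arXiv:1006.1002v2 numbering)] -/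
theorem exists_cone1_subst {f : BinaryQuartic ℝ} (hΔ : f.disc < 0) :
    (∃ m τ : ℝ, 0 < m ∧ τ ∈ Set.Icc (-2 : ℝ) 2 ∧
      ∃ γ : Matrix (Fin 2) (Fin 2) ℝ, (γ.det = 1 ∨ γ.det = -1) ∧ f = (m • curve1B.c τ).subst γ) ∨
    (∃ m τ : ℝ, 0 < m ∧ τ ∈ Set.Ioo (-1 : ℝ) 1 ∧
      ∃ γ : Matrix (Fin 2) (Fin 2) ℝ, (γ.det = 1 ∨ γ.det = -1) ∧ f = (m • curve1C.c τ).subst γ) ∨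
    (∃ m τ : ℝ, 0 < m ∧ τ ∈ Set.Ioo (-1 : ℝ) 1 ∧
      ∃ γ : Matrix (Fin 2) (Fin 2) ℝ, (γ.det = 1 ∨ γ.det = -1) ∧ f = (m • curve1D.c τ).subst γ) := by
  have h27 := twentySeven_mul_disc f
  have hJI : 4 * f.I ^ 3 < f.J ^ 2 := by linarith
  by_cases hcase : f.J ^ 2 ≤ 4 * |f.I| ^ 3
  · -- piece B: `I < 0`
    left
    have hIneg : f.I < 0 := by
      by_contra hge
      push Not at hge
      rw [abs_of_nonneg hge] at hcase
      linarith
    set m : ℝ := Real.sqrt (-f.I) with hm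
    have hm0 : 0 < m := Real.sqrt_pos.2 (by linarith)
    have hm2 : m ^ 2 = -f.I := Real.sq_sqrt (by linarith)
    have hm3 : m ^ 3 ≠ 0 := by positivity
    set τ : ℝ := f.J / m ^ 3 with hτ
    have hJ' : m ^ 3 * τ = f.J := by rw [hτ]; field_simp
    have hτ2 : τ ^ 2 ≤ 4 := by
      have h2 : f.J ^ 2 = m ^ 6 * τ ^ 2 := by rw [← hJ']; ring
      have h3 : |f.I| ^ 3 = m ^ 6 := by rw [abs_of_neg hIneg, ← hm2]; ring
      rw [h2, h3] at hcase
      have hm6 : 0 < m ^ 6 := by positivity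
      nlinarith
    have hτmem : τ ∈ Set.Icc (-2 : ℝ) 2 := by
      constructor <;> nlinarith [hτ2, sq_nonneg (τ + 2), sq_nonneg (τ - 2)]
    refine ⟨m, τ, hm0, hτmem, ?_⟩
    have hIP : (m • curve1B.c τ).I = f.I := by rw [I_cone1B_pt, hm2]; ring
    have hJP : (m • curve1B.c τ).J = f.J := by rw [J_cone1B_pt, hJ']
    have hΔP : (m • curve1B.c τ).disc < 0 := by rw [disc_eq_of_invariants_eq hIP hJP]; exact hΔ
    exact exists_subst_eq_of_disc_neg_of_invariants_eq hΔP hΔ hIP hJP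
  · push Not at hcase
    -- `|I|³ < J²/4`, so `J ≠ 0`; pieces C / D by the sign of `J`
    right
    have hJ0 : f.J ≠ 0 := by
      intro h0; rw [h0] at hcase
      have : 0 ≤ 4 * |f.I| ^ 3 := by positivity
      linarith
    rcases lt_or_gt_of_ne hJ0 with hJneg | hJpos
    · -- piece D
      right
      set m : ℝ := (-f.J / 2) ^ ((3 : ℕ) : ℝ)⁻¹ with hm
      have hb : 0 < -f.J / 2 := by linarith
      have hm0 : 0 < m := Real.rpow_pos_of_pos hb _
      have hm3 : m ^ 3 = -f.J / 2 := Real.rpow_inv_natCast_pow hb.le (by norm_num)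
      have hm2 : m ^ 2 ≠ 0 := by positivity
      set τ : ℝ := f.I / m ^ 2 with hτ
      have hI' : m ^ 2 * τ = f.I := by rw [hτ]; field_simp
      have hτ1 : |τ| < 1 := by
        have h2 : |f.I| ^ 3 = m ^ 6 * |τ| ^ 3 := by
          rw [← hI', abs_mul, abs_of_pos (by positivity : (0:ℝ) < m ^ 2)]; ring
        have h3 : f.J ^ 2 = 4 * m ^ 6 := by nlinarith [hm3]
        rw [h2, h3] at hcase
        have hm6 : 0 < m ^ 6 := by positivity
        have : |τ| ^ 3 < 1 := by nlinarith
        by_contra hge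
        push Not at hge
        have : 1 ≤ |τ| ^ 3 := by
          calc (1:ℝ) = 1 ^ 3 := by norm_num
            _ ≤ |τ| ^ 3 := pow_le_pow_left₀ (by norm_num) hge 3
        linarith
      have hτmem : τ ∈ Set.Ioo (-1 : ℝ) 1 := by
        have := abs_lt.1 hτ1; exact ⟨this.1, this.2⟩
      refine ⟨m, τ, hm0, hτmem, ?_⟩
      have hIP : (m • curve1D.c τ).I = f.I := by rw [I_cone1D_pt, hI']
      have hJP : (m • curve1D.c τ).J = f.J := by rw [J_cone1D_pt, hm3]; ring
      have hΔP : (m • curve1D.c τ).disc < 0 := by rw [disc_eq_of_invariants_eq hIP hJP]; exact hΔ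
      exact exists_subst_eq_of_disc_neg_of_invariants_eq hΔP hΔ hIP hJP
    · -- piece C
      left
      set m : ℝ := (f.J / 2) ^ ((3 : ℕ) : ℝ)⁻¹ with hm
      have hb : 0 < f.J / 2 := by linarith
      have hm0 : 0 < m := Real.rpow_pos_of_pos hb _
      have hm3 : m ^ 3 = f.J / 2 := Real.rpow_inv_natCast_pow hb.le (by norm_num)
      have hm2 : m ^ 2 ≠ 0 := by positivity
      set τ : ℝ := f.I / m ^ 2 with hτ
      have hI' : m ^ 2 * τ = f.I := by rw [hτ]; field_simp
      have hτ1 : |τ| < 1 := by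
        have h2 : |f.I| ^ 3 = m ^ 6 * |τ| ^ 3 := by
          rw [← hI', abs_mul, abs_of_pos (by positivity : (0:ℝ) < m ^ 2)]; ring
        have h3 : f.J ^ 2 = 4 * m ^ 6 := by nlinarith [hm3]
        rw [h2, h3] at hcase
        have hm6 : 0 < m ^ 6 := by positivity
        have : |τ| ^ 3 < 1 := by nlinarith
        by_contra hge
        push Not at hge
        have : 1 ≤ |τ| ^ 3 := by
          calc (1:ℝ) = 1 ^ 3 := by norm_num
            _ ≤ |τ| ^ 3 := pow_le_pow_left₀ (by norm_num) hge 3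
        linarith
      have hτmem : τ ∈ Set.Ioo (-1 : ℝ) 1 := by
        have := abs_lt.1 hτ1; exact ⟨this.1, this.2⟩
      refine ⟨m, τ, hm0, hτmem, ?_⟩
      have hIP : (m • curve1C.c τ).I = f.I := by rw [I_cone1C_pt, hI']
      have hJP : (m • curve1C.c τ).J = f.J := by rw [J_cone1C_pt, hm3]; ring
      have hΔP : (m • curve1C.c τ).disc < 0 := by rw [disc_eq_of_invariants_eq hIP hJP]; exact hΔ
      exact exists_subst_eq_of_disc_neg_of_invariants_eq hΔP hΔ hIP hJP

/-! ## Uniqueness of the cone point with given invariants -/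

/-- Positive reals with equal squares are equal. [folklore] -/
theorem eq_of_sq_eq_sq_pos {m m' : ℝ} (hm : 0 < m) (hm' : 0 < m') (h : m ^ 2 = m' ^ 2) : m = m' := by
  nlinarith [sq_nonneg (m - m'), sq_nonneg (m + m')]

/-- Positive reals with equal cubes are equal. [folklore] -/
theorem eq_of_cube_eq_cube_pos {m m' : ℝ} (hm : 0 < m) (hm' : 0 < m') (h : m ^ 3 = m' ^ 3) : m = m' := by
  by_contra hne
  rcases lt_or_gt_of_ne hne with hlt | hlt
  · have := pow_lt_pow_left₀ hlt hm.le (by norm_num : (3:ℕ) ≠ 0); linarith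
  · have := pow_lt_pow_left₀ hlt hm'.le (by norm_num : (3:ℕ) ≠ 0); linarith

/-- Uniqueness of the type-`0` cone point with given invariants. [folklore] -/
theorem cone0_params_unique {m m' τ τ' : ℝ} (hm : 0 < m) (hm' : 0 < m')
    (hI : (m • curve0.c τ).I = (m' • curve0.c τ').I) (hJ : (m • curve0.c τ).J = (m' • curve0.c τ').J) :
    m = m' ∧ τ = τ' := by
  rw [I_cone0_pt, I_cone0_pt] at hI
  rw [J_cone0_pt, J_cone0_pt] at hJ
  have hmm := eq_of_sq_eq_sq_pos hm hm' hI
  subst hmm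
  have hm3 : m ^ 3 ≠ 0 := by positivity
  exact ⟨rfl, mul_left_cancel₀ hm3 hJ⟩

/-- Uniqueness of the type-`2+` cone point with given invariants. [folklore] -/
theorem cone2_params_unique {m m' s s' : ℝ} (hm : 0 < m) (hm' : 0 < m')
    (hs : s ∈ Set.Icc (-2 : ℝ) 2) (hs' : s' ∈ Set.Icc (-2 : ℝ) 2)
    (hI : (m • curve2.c s).I = (m' • curve2.c s').I) (hJ : (m • curve2.c s).J = (m' • curve2.c s').J) :
    m = m' ∧ s = s' := by
  rw [I_cone2_pt, I_cone2_pt] at hI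
  rw [J_cone2_pt, J_cone2_pt] at hJ
  have hmm := eq_of_sq_eq_sq_pos hm hm' hI
  subst hmm
  have hm3 : m ^ 3 ≠ 0 := by positivity
  exact ⟨rfl, injOn_jfun hs hs' (mul_left_cancel₀ hm3 hJ)⟩

/-- Uniqueness within piece `B`. [folklore] -/
theorem cone1B_params_unique {m m' τ τ' : ℝ} (hm : 0 < m) (hm' : 0 < m')
    (hI : (m • curve1B.c τ).I = (m' • curve1B.c τ').I) (hJ : (m • curve1B.c τ).J = (m' • curve1B.c τ').J) :
    m = m' ∧ τ = τ' := by
  rw [I_cone1B_pt, I_cone1B_pt] at hI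
  rw [J_cone1B_pt, J_cone1B_pt] at hJ
  have hmm := eq_of_sq_eq_sq_pos hm hm' (by linarith)
  subst hmm
  have hm3 : m ^ 3 ≠ 0 := by positivity
  exact ⟨rfl, mul_left_cancel₀ hm3 hJ⟩

/-- Uniqueness within piece `C`. [folklore] -/
theorem cone1C_params_unique {m m' τ τ' : ℝ} (hm : 0 < m) (hm' : 0 < m')
    (hI : (m • curve1C.c τ).I = (m' • curve1C.c τ').I) (hJ : (m • curve1C.c τ).J = (m' • curve1C.c τ').J) :
    m = m' ∧ τ = τ' := by
  rw [I_cone1C_pt, I_cone1C_pt] at hI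
  rw [J_cone1C_pt, J_cone1C_pt] at hJ
  have hmm := eq_of_cube_eq_cube_pos hm hm' (by linarith)
  subst hmm
  have hm2 : m ^ 2 ≠ 0 := by positivity
  exact ⟨rfl, mul_left_cancel₀ hm2 hI⟩

/-- Uniqueness within piece `D`. [folklore] -/
theorem cone1D_params_unique {m m' τ τ' : ℝ} (hm : 0 < m) (hm' : 0 < m')
    (hI : (m • curve1D.c τ).I = (m' • curve1D.c τ').I) (hJ : (m • curve1D.c τ).J = (m' • curve1D.c τ').J) :
    m = m' ∧ τ = τ' := by
  rw [I_cone1D_pt, I_cone1D_pt] at hI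
  rw [J_cone1D_pt, J_cone1D_pt] at hJ
  have hmm := eq_of_cube_eq_cube_pos hm hm' (by linarith)
  subst hmm
  have hm2 : m ^ 2 ≠ 0 := by positivity
  exact ⟨rfl, mul_left_cancel₀ hm2 hI⟩

/-- The three type-`1` pieces are separated by their invariants: `B` has `J² ≤ 4|I|³`, `C` and
`D` have `4|I|³ < J²`, and `C`, `D` differ by the sign of `J`. [folklore] -/
theorem cone1B_invariants (m : ℝ) {τ : ℝ} (hτ : τ ∈ Set.Icc (-2 : ℝ) 2) :
    (m • curve1B.c τ).J ^ 2 ≤ 4 * |(m • curve1B.c τ).I| ^ 3 := by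
  rw [I_cone1B_pt, J_cone1B_pt, abs_neg, abs_of_nonneg (sq_nonneg m)]
  have : τ ^ 2 ≤ 4 := by nlinarith [hτ.1, hτ.2]
  have hm6 : 0 ≤ m ^ 6 := by positivity
  nlinarith

/-- Piece `C` has `4|I|³ < J²` and `J > 0`. [folklore] -/
theorem cone1C_invariants {m : ℝ} (hm : 0 < m) {τ : ℝ} (hτ : τ ∈ Set.Ioo (-1 : ℝ) 1) :
    4 * |(m • curve1C.c τ).I| ^ 3 < (m • curve1C.c τ).J ^ 2 ∧ 0 < (m • curve1C.c τ).J := by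
  rw [I_cone1C_pt, J_cone1C_pt, abs_mul, abs_of_nonneg (sq_nonneg m)]
  have h1 : |τ| < 1 := abs_lt.2 ⟨hτ.1, hτ.2⟩
  have h3 : |τ| ^ 3 < 1 := by
    calc |τ| ^ 3 < 1 ^ 3 := pow_lt_pow_left₀ h1 (abs_nonneg _) (by norm_num)
      _ = 1 := by norm_num
  have hm6 : 0 < m ^ 6 := by positivity
  refine ⟨by nlinarith, by positivity⟩

/-- Piece `D` has `4|I|³ < J²` and `J < 0`. [folklore] -/
theorem cone1D_invariants {m : ℝ} (hm : 0 < m) {τ : ℝ} (hτ : τ ∈ Set.Ioo (-1 : ℝ) 1) :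
    4 * |(m • curve1D.c τ).I| ^ 3 < (m • curve1D.c τ).J ^ 2 ∧ (m • curve1D.c τ).J < 0 := by
  rw [I_cone1D_pt, J_cone1D_pt, abs_mul, abs_of_nonneg (sq_nonneg m)]
  have h1 : |τ| < 1 := abs_lt.2 ⟨hτ.1, hτ.2⟩
  have h3 : |τ| ^ 3 < 1 := by
    calc |τ| ^ 3 < 1 ^ 3 := pow_lt_pow_left₀ h1 (abs_nonneg _) (by norm_num)
      _ = 1 := by norm_num
  have hm6 : 0 < m ^ 6 := by positivity
  have hm3 : 0 < m ^ 3 := by positivity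
  refine ⟨by nlinarith, by linarith [hm3]⟩

end BinaryQuartic

end Literature.NumberTheory.EllipticCurves

end
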